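import Literature.AlgebraicTopology.SingularHomology.LocalHomologyCoeffSpan
import Literature.AlgebraicTopology.SingularHomology.ClosedManifoldHomologyProofs
import Literature.AlgebraicTopology.SingularHomology.LocalHomologyIso
import Literature.AlgebraicTopology.SingularHomology.LinearLocalDegree
import Literature.AlgebraicTopology.SingularHomology.ExcisionTheorem
import HarnessLib

/-!
# Maps of pairs which agree on `Hₙ(X | K; ℤ)` agree on `Hₙ(X | K; M)` for all coefficients;
# linear maps of positive determinant act as the identity on `Hₙ(ℝⁿ | 0; M)`

A. Hatcher, *Algebraic Topology* (2002), §3.3 p. 235 ("In view of the canonical isomorphism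
`Hₙ(M | x; R) ≈ Hₙ(M | x) ⊗ R` …") and §2.2 Exercise 7 / §3.3 p. 233 (invertible linear maps
act on `Hₙ(ℝⁿ, ℝⁿ - 0)` by the sign of the determinant; "rotations preserve local orientations").
The tree proves the latter with INTEGER coefficients
(`localHomology_map_continuousLinearMap_of_det_pos`, file `LinearLocalDegree`); this file
transports such statements to arbitrary coefficient modules `M` over arbitrary rings `R`, without
the universal coefficient theorem, through the tree's coefficient-change maps
(`clocalHomology.coeffMap`, `coeffElemHom`, `coeffElemHom_surjective`, files
`LocalHomologyCoeffChange`, `LocalHomologyCoeffSpan`):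

* `clocalHomology.map_coeffMap_apply` — **change of coefficients commutes with maps of pairs**
  (`f_* (g ∘ z) = g ∘ (f_* z)` on chains: `Finsupp.mapDomain_mapRange`);
* `clocalHomology.map_eq_map_of_int` — if `Hₙ(X | K; ℤ)` is generated by a class `μ` and
  `Hₙ₋₁(X | K; A') = 0` for all abelian groups `A'`, two maps of pairs `f, f' : (X | K) → (Y | L)`
  with `f_* μ = f'_* μ` in `Hₙ(Y | L; ℤ)` induce the SAME map `Hₙ(X | K; M) → Hₙ(Y | L; M)` for
  every `R`-module `M` (every class is `(k ↦ k • m)_* μ`, `coeffElemHom_surjective`); the same in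
  Mathlib's model, `relativeSingularHomology.map_eq_map_of_int`;
* `localHomology_map_continuousLinearMap_of_det_pos_coeff` — **a continuous linear map `A` of
  `EuclideanSpace ℝ (Fin n)` with `det A > 0` acts as the identity on `Hₙ(ℝⁿ | 0; M)`** for every
  commutative ring `R` and `R`-module `M` (Hatcher Ex. 2.2.7 with p. 235).

Everything is proved; no definitions, no named facts.

## References

* [HatcherAT2002] A. Hatcher, Algebraic Topology, CUP 2002, §2.2 Exercise 7, §3.3 pp. 231, 233,
  235.
-/

noncomputable section

-- as in `SingularChainsConcrete` / `LocalHomology`: chains of the concrete complex are `Finsupp`s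
-- up to unfolding of semireducible definitions
set_option backward.isDefEq.respectTransparency false

open CategoryTheory Limits Set

universe u v v'

namespace Literature.AlgebraicTopology.SingularHomology

/-! ### Change of coefficients commutes with maps of pairs -/

namespace clocalHomology

section Naturality

variable {R : Type v} [CommRing R] {R' : Type v'} [CommRing R']
variable {A : Type v} [AddCommGroup A] [Module R A] {A' : Type v'} [AddCommGroup A'] [Module R' A']
variable {X Y : Type u} [TopologicalSpace X] [TopologicalSpace Y]

/-- **Change of coefficients commutes with maps of pairs**: for `f : (X, X ∖ K) → (Y, Y ∖ L)` and
an additive `g : A → A'`, `g_* (f_* a) = f_* (g_* a)` on `Hᵢ(X | K; ·)` (Hatcher 2002, §2.2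
p. 153: the coefficient homomorphism is natural). [cite: HatcherAT2002, §2.2 p. 153] -/
theorem map_coeffMap_apply (g : A →+ A') {K : Set X} {L : Set Y} (f : C(X, Y)) (h : MapsTo f Kᶜ Lᶜ)
    (i : ℕ) (a : clocalHomology R A X K i) :
    map R' A' f h i (coeffMap R R' g K i a) = coeffMap R R' g L i (map R A f h i a) := by
  obtain ⟨z, hz, rfl⟩ := (awaySub R A X K).relCls_surjective a
  rw [coeffMap_relCls, map, quotChainMap, Subcomplex.homologyMap_quotMap_relCls, map, quotChainMap,
    Subcomplex.homologyMap_quotMap_relCls, coeffMap_relCls]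
  refine (awaySub R' A' Y L).relCls_congr ?_ _ _
  rw [csingularChainComplex.map_f_apply, csingularChainComplex.map_f_apply]
  exact Finsupp.mapDomain_mapRange _ _ _ (map_zero g) (map_add g)

end Naturality

/-! ### Maps of pairs agreeing integrally agree for all coefficients -/

section IntToCoeff

variable {X Y : Type u} [TopologicalSpace X] [TopologicalSpace Y]

/-- **Two maps of pairs which agree on an integral generator agree with all coefficients.** Let
`μ ∈ Hₙ(X | K; ℤ)` be a generator (`e μ = 1` under some `Hₙ(X | K; ℤ) ≃ ℤ`) with
`Hₙ₋₁(X | K; A') = 0` for all abelian groups `A'`, and `f, f' : (X, X ∖ K) → (Y, Y ∖ L)` maps of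
pairs with `f_* μ = f'_* μ`. Then `f_* = f'_*` on `Hₙ(X | K; M) → Hₙ(Y | L; M)` for every module `M`
over every commutative ring `R` (Hatcher 2002, §3.3 p. 235: `Hₙ(· | ·; R) = Hₙ(· | ·) ⊗ R`-type
reasoning, here through `coeffElemHom_surjective`). [cite: HatcherAT2002, §3.3 p. 235] -/
theorem map_eq_map_of_int {K : Set X} {L : Set Y} {n : ℕ} (μ : clocalHomology ℤ ℤ X K n)
    (e : clocalHomology ℤ ℤ X K n ≃ₗ[ℤ] ℤ) (he : e μ = 1)
    (hvan : ∀ (A' : Type) [AddCommGroup A'] [Module ℤ A'] (j : ℕ), j + 1 = n →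
      IsZero (clocalHomology ℤ A' X K j))
    (f f' : C(X, Y)) (hf : MapsTo f Kᶜ Lᶜ) (hf' : MapsTo f' Kᶜ Lᶜ)
    (hμ : map ℤ ℤ f hf n μ = map ℤ ℤ f' hf' n μ)
    (R : Type v) [CommRing R] (M : Type v) [AddCommGroup M] [Module R M] :
    map R M f hf n = (map R M f' hf' n : clocalHomology R M X K n ⟶ clocalHomology R M Y L n) := by
  refine ModuleCat.hom_ext (LinearMap.ext fun a ↦ ?_)
  obtain ⟨m, rfl⟩ := coeffElemHom_surjective (S := R) (A := M) (μ := μ) hvan e he a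
  change map R M f hf n (coeffMap ℤ R (zmultiplesHom M m) K n μ) =
    map R M f' hf' n (coeffMap ℤ R (zmultiplesHom M m) K n μ)
  rw [map_coeffMap_apply, map_coeffMap_apply, hμ]

end IntToCoeff

end clocalHomology

/-! ### The same in Mathlib's model -/

namespace relativeSingularHomology

variable {X Y : Type u} [TopologicalSpace X] [TopologicalSpace Y]

/-- Mathlib's `f_*` on `Hₙ(X | K)` is conjugate to the concrete `clocalHomology.map` under
`concreteIso` (element form of `map_eq_concrete`). [folklore] -/
lemma concreteIso_hom_map {R : Type v} [CommRing R] {M : Type v} [AddCommGroup M] [Module R M]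
    {K : Set X} {L : Set Y} (f : C(X, Y)) (hf : MapsTo f Kᶜ Lᶜ) (n : ℕ) (x : localHomologyOfSet R M X K n) :
    (concreteIso R M Y Lᶜ n).hom (map R M f hf n x) =
      clocalHomology.map R M f hf n ((concreteIso R M X Kᶜ n).hom x) := by
  rw [map_eq_concrete, ModuleCat.comp_apply, ModuleCat.comp_apply, Iso.inv_hom_id_apply]
  rfl

/-- **Two maps of pairs which agree on `Hₙ(X | K; ℤ)` agree on `Hₙ(X | K; M)`** (Mathlib's model
`localHomologyOfSet`), under the hypotheses of `clocalHomology.map_eq_map_of_int` stated in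
Mathlib's model: `Hₙ(X | K; ℤ) ≅ ℤ` generated by `μ`, `Hₙ₋₁(X | K; A') = 0` for all `A'`, and
`f_* μ = f'_* μ`. [cite: HatcherAT2002, §3.3 p. 235] -/
theorem map_eq_map_of_int {K : Set X} {L : Set Y} {n : ℕ} (μ : localHomologyOfSet ℤ ℤ X K n)
    (e : localHomologyOfSet ℤ ℤ X K n ≃ₗ[ℤ] ℤ) (he : e μ = 1)
    (hvan : ∀ (A' : Type) [AddCommGroup A'] [Module ℤ A'] (j : ℕ), j + 1 = n →
      IsZero (localHomologyOfSet ℤ A' X K j))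
    (f f' : C(X, Y)) (hf : MapsTo f Kᶜ Lᶜ) (hf' : MapsTo f' Kᶜ Lᶜ)
    (hμ : map ℤ ℤ f hf n μ = map ℤ ℤ f' hf' n μ)
    (R : Type v) [CommRing R] (M : Type v) [AddCommGroup M] [Module R M] :
    map R M f hf n = (map R M f' hf' n : localHomologyOfSet R M X K n ⟶ localHomologyOfSet R M Y L n) := by
  -- the concrete data
  let ι := concreteIso ℤ ℤ X Kᶜ n
  let μ' : clocalHomology ℤ ℤ X K n := ι.hom μ
  let e' : clocalHomology ℤ ℤ X K n ≃ₗ[ℤ] ℤ := ι.toLinearEquiv.symm.trans e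
  have he' : e' μ' = 1 := by
    change e (ι.inv (ι.hom μ)) = 1
    rw [Iso.hom_inv_id_apply, he]
  have hvan' : ∀ (A' : Type) [AddCommGroup A'] [Module ℤ A'] (j : ℕ), j + 1 = n →
      IsZero (clocalHomology ℤ A' X K j) :=
    fun A' _ _ j hj ↦ (hvan A' j hj).of_iso (concreteIso ℤ A' X Kᶜ j).symm
  have hμ' : clocalHomology.map ℤ ℤ f hf n μ' = clocalHomology.map ℤ ℤ f' hf' n μ' := by
    change clocalHomology.map ℤ ℤ f hf n (ι.hom μ) = clocalHomology.map ℤ ℤ f' hf' n (ι.hom μ)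
    rw [← concreteIso_hom_map, ← concreteIso_hom_map, hμ]
  have key := clocalHomology.map_eq_map_of_int μ' e' he' hvan' f f' hf hf' hμ' R M
  refine ModuleCat.hom_ext (LinearMap.ext fun x ↦ ?_)
  apply (concreteIso R M Y Lᶜ n).toLinearEquiv.injective
  change (concreteIso R M Y Lᶜ n).hom (map R M f hf n x) = (concreteIso R M Y Lᶜ n).hom (map R M f' hf' n x)
  rw [concreteIso_hom_map, concreteIso_hom_map, key]

end relativeSingularHomology

/-! ### Linear maps of positive determinant act as the identity on `Hₙ(ℝⁿ | 0; M)` -/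

section Linear

variable {n : ℕ}

/-- **Hatcher's Exercise 2.2.7 with arbitrary coefficients.** A continuous linear map `A` of
`EuclideanSpace ℝ (Fin n)` with `det A > 0` acts as the identity on the local homology
`Hₙ(ℝⁿ | 0; M)` for every commutative ring `R` and every `R`-module `M` (the integral case is the
tree's `localHomology_map_continuousLinearMap_of_det_pos`; the passage to `M` is Hatcher 2002,
§3.3 p. 235). [cite: HatcherAT2002, §2.2 Exercise 7] [cite: HatcherAT2002, §3.3 p. 235] -/
theorem localHomology_map_continuousLinearMap_of_det_pos_coeff
    (R : Type v) [CommRing R] (M : Type v) [AddCommGroup M] [Module R M]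
    (A : EuclideanSpace ℝ (Fin n) →L[ℝ] EuclideanSpace ℝ (Fin n))
    (hA : 0 < LinearMap.det (A : EuclideanSpace ℝ (Fin n) →ₗ[ℝ] EuclideanSpace ℝ (Fin n))) :
    relativeSingularHomology.map R M (A : C(EuclideanSpace ℝ (Fin n), EuclideanSpace ℝ (Fin n)))
      (mapsTo_continuousLinearMap_of_det_ne_zero hA.ne') n = 𝟙 (localHomology R M (EuclideanSpace ℝ (Fin n)) 0 n) := by
  -- the integral generator and the vanishing below degree `n`
  obtain ⟨ι⟩ := nonempty_localHomology_iso_holds ℤ (EuclideanSpace ℝ (Fin n)) (n := n) (0 : EuclideanSpace ℝ (Fin n))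
  let e : localHomology ℤ ℤ (EuclideanSpace ℝ (Fin n)) 0 n ≃ₗ[ℤ] ℤ :=
    ι.toLinearEquiv.trans (ULift.moduleEquiv : ULift.{0} ℤ ≃ₗ[ℤ] ℤ)
  have hvan : ∀ (A' : Type) [AddCommGroup A'] [Module ℤ A'] (j : ℕ), j + 1 = n →
      IsZero (localHomologyOfSet ℤ A' (EuclideanSpace ℝ (Fin n)) {(0 : EuclideanSpace ℝ (Fin n))} j) :=
    fun A' _ _ j hj ↦ isZero_localHomology_of_ne (n := n) ℤ A' (0 : EuclideanSpace ℝ (Fin n)) (by omega)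
  have hμ := localHomology_map_continuousLinearMap_of_det_pos A hA
  have key := relativeSingularHomology.map_eq_map_of_int (e.symm 1) e (e.apply_symm_apply 1) hvan
    (A : C(EuclideanSpace ℝ (Fin n), EuclideanSpace ℝ (Fin n))) (ContinuousMap.id _)
    (mapsTo_continuousLinearMap_of_det_ne_zero hA.ne') (mapsTo_id _)
    (by rw [hμ, relativeSingularHomology.map_id]) R M
  rw [key, relativeSingularHomology.map_id]

end Linear

end Literature.AlgebraicTopology.SingularHomology
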